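import Mathlib.Analysis.Calculus.ContDiff.Deriv
import Literature.Geometry.Lorentzian.ConformalCoordCurvature
import HarnessLib

/-!
# The coordinate Laplace–Beltrami operator: chain rule and the sign of `|∇u|²`

Support file (all results proved) for Schoen–Yau's superharmonic conformal factor
(Comm. Math. Phys. 65 (1979), §2 Step 1, (2.2)–(2.3): `φ = 1 + ζ(-M/4r)`,
`Δφ = ζ' Δ(-M/4r) + ζ'' |∇(-M/4r)|² ≤ 0`). In the `MetricCoord` framework (`hessAt`, `lapAt` of
`CoordScalarCurvatureEvolution.lean`):

* `MetricCoord.fderiv_fderiv_comp_apply` — `D²(g ∘ u)(v,w) = g'(u) D²u(v,w) + g''(u) Du(v) Du(w)`;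
* `MetricCoord.hessAt_comp`, `MetricCoord.lapAt_comp` — **the chain rule**
  `Hess_G (g ∘ u) = g'(u) Hess_G u + g''(u) du ⊗ du`, `Δ_G (g ∘ u) = g'(u) Δ_G u + g''(u) du(♯du)`
  (O'Neill 1983, Ch. 3, Def. 3.48–3.50 with the ordinary chain rule);
* `MetricCoord.apply_sharpAt_self_nonneg` — `α(♯α) = G(♯α, ♯α) ≥ 0` for positive semidefinite
  `G_y`, the sign of `|∇u|²_G = du(♯du)`.

(The identification of the prelude's `dalembertian` on `U : Opens E` with `lapAt` of the
representative is `OpensChart.dalembertian_eq_lapAt` of `ChartMetricCoord.lean`.)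

No statement of `Prop` type is introduced.

## References

* B. O'Neill, *Semi-Riemannian geometry*, Academic Press 1983, Ch. 3, Prop. 3.13, Def. 3.48,
  Lemma 3.49, Def. 3.50. [ONeill1983]
* R. Schoen, S.-T. Yau, *On the proof of the positive mass conjecture in general relativity*,
  Comm. Math. Phys. 65 (1979), §2 Step 1, (2.3), p. 49. [SchoenYauPMT1979]
-/

noncomputable section

set_option maxSynthPendingDepth 3

open Set Filter ContinuousLinearMap Module
open scoped Topology ContDiff

namespace Literature.Geometry.Lorentzian

namespace MetricCoord

/-! ### The chain rule for the coordinate Hessian and Laplacian -/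

section ChainRule

variable {E : Type*} [NormedAddCommGroup E] [NormedSpace ℝ E] {G : E → E →L[ℝ] E →L[ℝ] ℝ}
  {g : ℝ → ℝ} {u : E → ℝ} {y : E}

/-- The first derivative of `g ∘ u`: `D(g ∘ u)(y) = g'(u y) Du(y)`. [folklore] -/
theorem fderiv_comp_eq (hg : ContDiff ℝ 2 g) (hu : DifferentiableAt ℝ u y) :
    fderiv ℝ (fun z ↦ g (u z)) y = deriv g (u y) • fderiv ℝ u y :=
  ((hg.differentiable (by norm_num) (u y)).hasDerivAt.comp_hasFDerivAt y hu.hasFDerivAt).fderiv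

/-- **The second derivative of `g ∘ u`**: for `g` of class `C²` and `u` of class `C²` at `y`,
`D²(g ∘ u)(y) = g'(u y) D²u(y) + g''(u y) Du(y) ⊗ Du(y)`. [folklore] -/
theorem hasFDerivAt_fderiv_comp (hg : ContDiff ℝ 2 g) (hu : ContDiffAt ℝ 2 u y) :
    HasFDerivAt (fderiv ℝ fun z ↦ g (u z))
      (deriv g (u y) • fderiv ℝ (fderiv ℝ u) y
        + (deriv (deriv g) (u y) • fderiv ℝ u y).smulRight (fderiv ℝ u y)) y := by
  -- near `y` the first derivative is `g'(u) Du`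
  have hev : ∀ᶠ z in 𝓝 y, ContDiffAt ℝ 2 u z := hu.eventually (by simp)
  have heq : (fderiv ℝ fun z ↦ g (u z)) =ᶠ[𝓝 y] fun z ↦ deriv g (u z) • fderiv ℝ u z :=
    hev.mono fun z hz ↦ fderiv_comp_eq hg (hz.differentiableAt (by norm_num))
  refine HasFDerivAt.congr_of_eventuallyEq ?_ heq
  have hg1 : Differentiable ℝ (deriv g) :=
    (contDiff_succ_iff_deriv.1 (show ContDiff ℝ (1 + 1) g from hg)).2.2.differentiable one_ne_zero
  have hud : HasFDerivAt u (fderiv ℝ u y) y := (hu.differentiableAt (by norm_num)).hasFDerivAt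
  have h1 : HasFDerivAt (fun z ↦ deriv g (u z)) (deriv (deriv g) (u y) • fderiv ℝ u y) y :=
    (hg1 (u y)).hasDerivAt.comp_hasFDerivAt y hud
  have h2 : HasFDerivAt (fderiv ℝ u) (fderiv ℝ (fderiv ℝ u) y) y :=
    ((hu.fderiv_right (m := 1) le_rfl).differentiableAt one_ne_zero).hasFDerivAt
  exact h1.smul h2

/-- Evaluated form: `D²(g ∘ u)(y)(v, w) = g'(u y) D²u(y)(v,w) + g''(u y) Du(y)(v) Du(y)(w)`.
[folklore] -/
theorem fderiv_fderiv_comp_apply (hg : ContDiff ℝ 2 g) (hu : ContDiffAt ℝ 2 u y) (v w : E) :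
    fderiv ℝ (fderiv ℝ fun z ↦ g (u z)) y v w =
      deriv g (u y) * fderiv ℝ (fderiv ℝ u) y v w
        + deriv (deriv g) (u y) * fderiv ℝ u y v * fderiv ℝ u y w := by
  rw [(hasFDerivAt_fderiv_comp hg hu).fderiv]
  simp only [_root_.add_apply, _root_.smul_apply, smul_eq_mul,
    ContinuousLinearMap.smulRight_apply]

/-- **The chain rule for the coordinate Hessian**:
`Hess_G (g ∘ u)(y) = g'(u y) Hess_G u (y) + g''(u y) Du(y) ⊗ Du(y)` (O'Neill 1983, Ch. 3,
Def. 3.48 with Lemma 3.49, in the coordinates of `hessAt`). [cite: ONeill1983, Ch. 3, Lemma 3.49] -/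
theorem hessAt_comp (hg : ContDiff ℝ 2 g) (hu : ContDiffAt ℝ 2 u y) :
    hessAt G (fun z ↦ g (u z)) y =
      deriv g (u y) • hessAt G u y
        + deriv (deriv g) (u y) • (fderiv ℝ u y).smulRight (fderiv ℝ u y) := by
  ext v w
  rw [hessAt_apply, fderiv_fderiv_comp_apply hg hu,
    fderiv_comp_eq hg (hu.differentiableAt (by norm_num))]
  simp only [_root_.add_apply, _root_.smul_apply, smul_eq_mul,
    ContinuousLinearMap.smulRight_apply, hessAt_apply]
  ring

variable [FiniteDimensional ℝ E]

/-- **The chain rule for the coordinate Laplace–Beltrami operator**: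
`Δ_G (g ∘ u)(y) = g'(u y) Δ_G u (y) + g''(u y) |∇u|²_G (y)` with `|∇u|²_G = Du(♯ Du)`
(O'Neill 1983, Ch. 3, Def. 3.50; the formula `Δ(ζ ∘ u) = ζ' Δu + ζ'' |∇u|²` behind Schoen–Yau
1979, (2.3)). [cite: ONeill1983, Ch. 3, Def. 3.50] -/
theorem lapAt_comp (hg : ContDiff ℝ 2 g) (hu : ContDiffAt ℝ 2 u y) :
    lapAt G (fun z ↦ g (u z)) y =
      deriv g (u y) * lapAt G u y
        + deriv (deriv g) (u y) * fderiv ℝ u y (sharpAt G y (fderiv ℝ u y)) := by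
  rw [lapAt, hessAt_comp hg hu, mtrAt_add, mtrAt_smul, mtrAt_smul, mtrAt_smulRight, ← lapAt]

omit [FiniteDimensional ℝ E] in
/-- **`|∇u|²_G ≥ 0` for a positive semidefinite metric**: `α(♯α) = G(♯α, ♯α) ≥ 0`. [folklore] -/
theorem apply_sharpAt_self_nonneg (hy : (G y).IsInvertible) (hpos : ∀ v : E, 0 ≤ G y v v)
    (α : E →L[ℝ] ℝ) : 0 ≤ α (sharpAt G y α) := by
  rw [← apply_sharpAt_apply hy α (sharpAt G y α)]
  exact hpos _

end ChainRule

end MetricCoord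


end Literature.Geometry.Lorentzian

end
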